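import Mathlib
import HarnessLib
import Literature.AlgebraicGeometry.Ramification.InertiaNormalSylow
import Literature.AlgebraicGeometry.Resolution.PointBlowupHsFunMono
import Literature.AlgebraicGeometry.Resolution.BlowupsEquivariant
import Summits.ResolutionOfSingularities.ResolutionOfSingularities.Theorems.WildQuotientsWildQuotientResolutionStubPointBlowupStalkData
import Summits.ResolutionOfSingularities.ResolutionOfSingularities.Theorems.WildQuotientsWildQuotientResolutionInertLocusStalk

/-!
# The reduced inert locus of a tame normal subgroup is a `G`-stable REGULAR centre
# (crux `WildQuotients.WildQuotientResolution`, stub `stub_phaseZeroHighDim`; scheme plumbing of tame centres, any dimension)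

Crux stmt-ResolutionOfSingularities-15640 (`WildQuotientResolution`), registered stub `stub_phaseZeroHighDim`.
Continuation of ✓`InertLocusStalk` (p819500: the stalk of the reduced ideal sheaf `𝓘_{Z_K}` of the inert locus
`Z_K = {y | K ≤ I_y}` at a point `x ∈ Z_K` with regular local ring in which `|K|` is invertible is the
fixed-locus ideal `𝔞_K = ⨆_{k ∈ K} I_{τ k}` of the stalk action, with regular local quotient). This file turns
that into the two GLOBAL inputs which the equivariant blow-up theorems of the tree consume
(✓`CurveStep.curveMove`, ✓`CentreBlowupStalkData.centreBlowupStalkData`, `IsBlowup.liftAction`: a `G`-STABLE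
ideal sheaf — `𝒥.comap (ρ g) = 𝒥` — whose closed subscheme `V(𝒥)` is REGULAR):

* `mem_inertiaSubgroup_apply_iff_conj`, `preimage_inertLocus`, `preimage_inertLocus_of_normal` — `I_{g y} = g I_y g⁻¹`
  (AS2011 2.4; the tree's ✓`NpcCentre.inertiaSubgroup_apply_eq_map` states the same but its module has no farm
  build at present, so the membership form is re-derived here from ✓`mem_inertiaSubgroup_iff_comp_eq`), hence
  `(ρ g)⁻¹ Z_K = Z_{g⁻¹ K g}`, `= Z_K` for `K ⊴ G`;
* `comap_vanishingIdeal_inertLocus` — for `K ⊴ G`, `𝓘_{Z_K}` is `G`-stable (✓`vanishingIdeal_comap_eq_of_action`);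
* `isRegular_subscheme_vanishingIdeal_inertLocus` (+ `_of_coprime`) — if at every point of `Z_K` the local ring
  of `X` is regular and `|K|` is invertible in it (e.g. `|K|` prime to the residue characteristic `p`), the
  closed subscheme `V(𝓘_{Z_K})` is REGULAR (✓`isRegularLocalRing_stalk_subscheme_iff` +
  ✓`InertLocusStalk.isRegularLocalRing_quotient_stalkIdeal_inertLocus`, the stalk action supplied by
  ✓`PointBlowupStalkData.exists_stalkAction`);
* `tameInertLocusCentre` — the package: for a finite group acting on a regular `X` with inert loci closed and a
  normal subgroup `K` of order prime to the residue characteristics, `𝓘_{Z_K}` is a `G`-stable ideal sheaf with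
  regular subscheme whose stalk at each `x ∈ Z_K` is the fixed-locus ideal of the stalk action of `K ≤ I_x`.

[OURS · crux stmt-ResolutionOfSingularities-15640 · helper toward `stub_phaseZeroHighDim` (R-C of the all-dimensional
tame layer: tame fixed loci as global equivariant centres; NOT a proof of the stub); folklore, counted 0; AI-level
work, weaker than expert review.] [folklore; cf. AbbesSaito2011, 2.4]
-/

-- single-problem summit: the doubled namespace component `ResolutionOfSingularities` is forced
set_option linter.dupNamespace false

noncomputable section

namespace Summit.ResolutionOfSingularities.ResolutionOfSingularities.Theorems.WildQuotientResolution.InertLocusStalk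

open CategoryTheory AlgebraicGeometry TopologicalSpace IsLocalRing
open Literature.AlgebraicGeometry.Resolution Literature.AlgebraicGeometry.Ramification
open Summit.ResolutionOfSingularities.ResolutionOfSingularities.Theorems.WildQuotientResolution.PointBlowupStalkData

universe u

/-! ## Translation of inert loci: `I_{g y} = g I_y g⁻¹` -/

section Translation

variable {X : Scheme.{u}} {G : Type*} [Group G] (σ : G →* Aut X)

/-- **`I_{g y} = g I_y g⁻¹`, membership form**: `h ∈ I_{g y} ↔ g⁻¹ h g ∈ I_y` (apply AS2011's `I_ȳ = I_y` to the
point `Spec κ(y) → X —g→ X`). [folklore; cf. AbbesSaito2011, 2.4] -/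
-- adapted from ✓`NpcCentre.mem_inertiaSubgroup_apply_iff` (Theorems/…StubNpcCentre.lean, no farm build)
theorem mem_inertiaSubgroup_apply_iff_conj (g h : G) (y : X) :
    h ∈ inertiaSubgroup σ ((σ g).hom.base y) ↔ g⁻¹ * h * g ∈ inertiaSubgroup σ y := by
  have key := mem_inertiaSubgroup_iff_comp_eq σ (X.fromSpecResidueField y ≫ (σ g).hom) h
  have e : (σ g).hom.base y =
      (X.fromSpecResidueField y ≫ (σ g).hom).base
        (closedPoint (ResidueField (X.presheaf.stalk y))) :=
    (congrArg (fun z => (σ g).hom.base z) (Scheme.fromSpecResidueField_apply y _)).symm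
  have key' : h ∈ inertiaSubgroup σ ((σ g).hom.base y) ↔
      (X.fromSpecResidueField y ≫ (σ g).hom) ≫ (σ h).hom = X.fromSpecResidueField y ≫ (σ g).hom :=
    (Iff.of_eq (congrArg (fun z => h ∈ inertiaSubgroup σ z) e)).trans key
  rw [key', mem_inertiaSubgroup_iff]
  simp only [map_mul, map_inv, aut_mul_hom, aut_inv_hom, Category.assoc]
  constructor
  · intro H
    calc X.fromSpecResidueField y ≫ (σ g).hom ≫ (σ h).hom ≫ (σ g).inv
        = (X.fromSpecResidueField y ≫ (σ g).hom ≫ (σ h).hom) ≫ (σ g).inv := by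
          simp only [Category.assoc]
      _ = X.fromSpecResidueField y := by
          rw [H, Category.assoc, Iso.hom_inv_id, Category.comp_id]
  · intro H
    calc X.fromSpecResidueField y ≫ (σ g).hom ≫ (σ h).hom
        = (X.fromSpecResidueField y ≫ (σ g).hom ≫ (σ h).hom ≫ (σ g).inv) ≫ (σ g).hom := by
          simp only [Category.assoc, Iso.inv_hom_id, Category.comp_id]
      _ = X.fromSpecResidueField y ≫ (σ g).hom := by rw [H]

/-- **Translates of inert loci**: `(ρ g)⁻¹ Z_K = Z_{g⁻¹ K g}`. [folklore] -/
theorem preimage_inertLocus (g : G) (K : Subgroup G) :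
    (σ g).hom.base ⁻¹' {y : X | K ≤ inertiaSubgroup σ y} =
      {y : X | K.map (MulAut.conj g⁻¹).toMonoidHom ≤ inertiaSubgroup σ y} := by
  ext y
  simp only [Set.mem_preimage, Set.mem_setOf_eq, Subgroup.map_le_iff_le_comap]
  constructor
  · intro h k hk
    rw [Subgroup.mem_comap, MulEquiv.coe_toMonoidHom, MulAut.conj_apply, inv_inv]
    exact (mem_inertiaSubgroup_apply_iff_conj σ g k y).mp (h hk)
  · intro h k hk
    have hk' := h hk
    rw [Subgroup.mem_comap, MulEquiv.coe_toMonoidHom, MulAut.conj_apply, inv_inv] at hk'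
    exact (mem_inertiaSubgroup_apply_iff_conj σ g k y).mpr hk'

/-- **The inert locus of a NORMAL subgroup is `G`-stable**: `(ρ g)⁻¹ Z_K = Z_K` for `K ⊴ G`. [folklore] -/
theorem preimage_inertLocus_of_normal (g : G) (K : Subgroup G) [hK : K.Normal] :
    (σ g).hom.base ⁻¹' {y : X | K ≤ inertiaSubgroup σ y} = {y : X | K ≤ inertiaSubgroup σ y} := by
  ext y
  simp only [Set.mem_preimage, Set.mem_setOf_eq]
  constructor
  · intro h k hk
    have h1 : g * k * g⁻¹ ∈ K := hK.conj_mem k hk g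
    have h2 := (mem_inertiaSubgroup_apply_iff_conj σ g (g * k * g⁻¹) y).mp (h h1)
    have e : g⁻¹ * (g * k * g⁻¹) * g = k := by group
    rwa [e] at h2
  · intro h k hk
    refine (mem_inertiaSubgroup_apply_iff_conj σ g k y).mpr (h ?_)
    have h1 := hK.conj_mem k hk g⁻¹
    rwa [inv_inv] at h1

/-- **The reduced ideal sheaf of the inert locus of a normal subgroup is `G`-stable** — the stability input
`𝒥.comap (ρ g) = 𝒥` of the equivariant blow-up theorems (`IsBlowup.liftAction`, ✓`CentreBlowupStalkData`).
[folklore] -/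
theorem comap_vanishingIdeal_inertLocus (K : Subgroup G) [K.Normal]
    (hZ : IsClosed {y : X | K ≤ inertiaSubgroup σ y}) (g : G) :
    (Scheme.IdealSheafData.vanishingIdeal ⟨{y : X | K ≤ inertiaSubgroup σ y}, hZ⟩).comap (σ g).hom =
      Scheme.IdealSheafData.vanishingIdeal ⟨{y : X | K ≤ inertiaSubgroup σ y}, hZ⟩ :=
  vanishingIdeal_comap_eq_of_action σ ⟨{y : X | K ≤ inertiaSubgroup σ y}, hZ⟩
    (fun g => preimage_inertLocus_of_normal σ g K) g

end Translation

/-! ## Regularity of the reduced inert locus of a tame subgroup -/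

section Regular

variable {X : Scheme.{0}} {G : Type} [Group G] (σ : G →* Aut X) (K : Subgroup G) [Finite K]

/-- A point of the closed subscheme `V(𝓘_{Z})` maps into `Z`. [folklore] -/
theorem subschemeι_base_mem {Z : Set X} (hZ : IsClosed Z)
    (s : (Scheme.IdealSheafData.vanishingIdeal ⟨Z, hZ⟩).subscheme) :
    (Scheme.IdealSheafData.vanishingIdeal ⟨Z, hZ⟩).subschemeι.base s ∈ Z := by
  have h : (Scheme.IdealSheafData.vanishingIdeal ⟨Z, hZ⟩).subschemeι.base s ∈
      ((Scheme.IdealSheafData.vanishingIdeal ⟨Z, hZ⟩).support : Set X) := by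
    rw [← Scheme.IdealSheafData.range_subschemeι]
    exact ⟨s, rfl⟩
  rw [Scheme.IdealSheafData.coe_support_vanishingIdeal] at h
  exact h

/-- **The reduced inert locus of a tame subgroup is a REGULAR closed subscheme**: if at every point `x` of the
closed inert locus `Z_K = {y | K ≤ I_y}` the local ring `𝒪_{X,x}` is regular and `|K|` is a unit of it, then
`V(𝓘_{Z_K})` is a regular scheme — its local ring at `x` is `𝒪_{X,x} ⧸ 𝔞_K`, regular by ✓`TameFixedLocus`.
[folklore] -/
theorem isRegular_subscheme_vanishingIdeal_inertLocus (hZ : IsClosed {y : X | K ≤ inertiaSubgroup σ y})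
    (hreg : ∀ x ∈ {y : X | K ≤ inertiaSubgroup σ y}, IsRegularLocalRing (X.presheaf.stalk x))
    (hKu : ∀ x ∈ {y : X | K ≤ inertiaSubgroup σ y}, IsUnit ((Nat.card K : ℕ) : X.presheaf.stalk x)) :
    Scheme.IsRegular
      (Scheme.IdealSheafData.vanishingIdeal ⟨{y : X | K ≤ inertiaSubgroup σ y}, hZ⟩).subscheme := by
  intro s
  set x := (Scheme.IdealSheafData.vanishingIdeal ⟨{y : X | K ≤ inertiaSubgroup σ y}, hZ⟩).subschemeι.base s
    with hxdef
  have hx : K ≤ inertiaSubgroup σ x := subschemeι_base_mem hZ s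
  haveI := hreg x hx
  rw [isRegularLocalRing_stalk_subscheme_iff]
  obtain ⟨a, τ, hkey, hτ⟩ := exists_stalkAction σ x (inertiaSubgroup σ x)
    (fun g hg => apply_eq_of_mem_inertiaSubgroup σ hg)
  exact isRegularLocalRing_quotient_stalkIdeal_inertLocus σ x a τ hkey hτ hx (hKu x hx) hx hZ

/-- The same with `|K|` prime to the residue characteristic `p` of the points of `Z_K`
(✓`TameFixedLocus.isUnit_natCast_of_not_dvd`). [folklore] -/
theorem isRegular_subscheme_vanishingIdeal_inertLocus_of_coprime (p : ℕ) [Fact p.Prime]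
    (hZ : IsClosed {y : X | K ≤ inertiaSubgroup σ y})
    (hreg : ∀ x ∈ {y : X | K ≤ inertiaSubgroup σ y}, IsRegularLocalRing (X.presheaf.stalk x))
    (hchar : ∀ x ∈ {y : X | K ≤ inertiaSubgroup σ y}, CharP (ResidueField (X.presheaf.stalk x)) p)
    (hcop : (Nat.card K).Coprime p) :
    Scheme.IsRegular
      (Scheme.IdealSheafData.vanishingIdeal ⟨{y : X | K ≤ inertiaSubgroup σ y}, hZ⟩).subscheme := by
  refine isRegular_subscheme_vanishingIdeal_inertLocus σ K hZ hreg fun x hx => ?_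
  haveI := hreg x hx
  haveI := hchar x hx
  exact TameFixedLocus.isUnit_natCast_of_not_dvd p
    ((Nat.Prime.coprime_iff_not_dvd (Fact.out : p.Prime)).mp hcop.symm)

/-- **Tame inert loci are global equivariant centres** (the package, crux stmt-ResolutionOfSingularities-15640,
toward `stub_phaseZeroHighDim`). Let the finite group `G` act on the scheme `X` all of whose local rings at the
points of `Z_K` are regular of residue characteristic `p`, and let `K ⊴ G` be a normal subgroup of order prime to
`p` whose inert locus `Z_K = {y | K ≤ I_y}` is closed (✓`isClosed_setOf_le_inertia`: automatic over a separated
invariant base). Then the reduced ideal sheaf `𝒥 = 𝓘_{Z_K}` is `G`-stable, its closed subscheme is regular, and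
at every `x ∈ Z_K`, for every stalk action `(a, τ)` of `I_x` (✓`exists_stalkAction`), `𝒥_x = ⨆_{k ∈ K} I_{τ k}`.
[folklore] -/
theorem tameInertLocusCentre (p : ℕ) [Fact p.Prime] [K.Normal]
    (hZ : IsClosed {y : X | K ≤ inertiaSubgroup σ y})
    (hreg : ∀ x ∈ {y : X | K ≤ inertiaSubgroup σ y}, IsRegularLocalRing (X.presheaf.stalk x))
    (hchar : ∀ x ∈ {y : X | K ≤ inertiaSubgroup σ y}, CharP (ResidueField (X.presheaf.stalk x)) p)
    (hcop : (Nat.card K).Coprime p) :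
    (∀ g : G, (Scheme.IdealSheafData.vanishingIdeal ⟨{y : X | K ≤ inertiaSubgroup σ y}, hZ⟩).comap
        (σ g).hom = Scheme.IdealSheafData.vanishingIdeal ⟨{y : X | K ≤ inertiaSubgroup σ y}, hZ⟩) ∧
    Scheme.IsRegular
      (Scheme.IdealSheafData.vanishingIdeal ⟨{y : X | K ≤ inertiaSubgroup σ y}, hZ⟩).subscheme ∧
    ∀ (x : X) (hx : K ≤ inertiaSubgroup σ x)
      (a : inertiaSubgroup σ x → (X.presheaf.stalk x ⟶ X.presheaf.stalk x))
      (τ : inertiaSubgroup σ x →* (X.presheaf.stalk x ≃+* X.presheaf.stalk x)),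
      (∀ g : inertiaSubgroup σ x,
        Spec.map (a g) ≫ X.fromSpecStalk x = X.fromSpecStalk x ≫ (σ (g : G)).hom) →
      (∀ (g : inertiaSubgroup σ x) (r : X.presheaf.stalk x), τ g r = (a g⁻¹).hom r) →
      stalkIdeal (Scheme.IdealSheafData.vanishingIdeal ⟨{y : X | K ≤ inertiaSubgroup σ y}, hZ⟩) x =
        ⨆ k : K, augIdeal ((τ.comp (Subgroup.inclusion hx)) k) := by
  refine ⟨comap_vanishingIdeal_inertLocus σ K hZ,
    isRegular_subscheme_vanishingIdeal_inertLocus_of_coprime σ K p hZ hreg hchar hcop, ?_⟩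
  intro x hx a τ hkey hτ
  haveI := hreg x hx
  haveI := hchar x hx
  have hKu : IsUnit ((Nat.card K : ℕ) : X.presheaf.stalk x) :=
    TameFixedLocus.isUnit_natCast_of_not_dvd p
      ((Nat.Prime.coprime_iff_not_dvd (Fact.out : p.Prime)).mp hcop.symm)
  exact stalkIdeal_vanishingIdeal_inertLocus_of_isUnit σ x a τ hkey hτ hx hKu hx hZ

end Regular

end Summit.ResolutionOfSingularities.ResolutionOfSingularities.Theorems.WildQuotientResolution.InertLocusStalk

end
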